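import Literature.Analysis.OperatorTheory.Enflo2023.MinimalNorm
import HarnessLib

/-!
# Enflo 2023, v2 pp.4–8: prose steps of Part A typed — ‖ℓ'(T)y'‖² = 1 − ε² − 2εθ, the εθ = 0 case, monotonicity/continuity (18), the coefficient bounds (22)–(23)

Source under adjudication: Per H. Enflo, *On the invariant subspace problem in Hilbert spaces*, arXiv:2305.15442 (v1
2023, v2 2024), bib key `Enflo2023` — a CLAIMED proof of the invariant subspace problem for operators on a separable
Hilbert space.  This file is part of the kernel-tight typing of the manuscript by the b2b-enflo repair cell
(formaliser 1, Part A: v2 eq. (1)–(27), the set-up, the constructions `V_y`, `ℓ'`, `[ ]x₀`, Lemma 1 and Case I/II of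
the main step).  It records what FOLLOWS (proved implications from the manuscript's displayed hypotheses) and, where a
step does not follow, the typed inference together with its refutation.  NOTHING here asserts that the manuscript's
main theorem holds; no declaration concludes the invariant subspace problem for an arbitrary operator.  Value
(BLOCK-2b): theorems / refutations of typed inferences about a text — not progress on the problem.

Small consequences of the minimal-vector set-up that the text uses in prose (STEPS.md §F1 rows A5, A7, A15, A19),
typed so that the Part A record has no prose-only arithmetic left before (20):
* `norm_sq_move` (v2 p.4 l.1–2, row A5): for `‖x₀‖ = 1`, `‖v‖² = 1 − ‖x₀ − v‖² − 2·Re⟨v, x₀ − v⟩`; with `v = ℓ'(T)y'`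
  the last term is `2εθ`, so `‖ℓ'(T)y'‖ ≤ 1` as soon as `εθ ≥ 0` (`norm_move_le_one`; the text: "(8) shows that
  `‖ℓ'(T)y'‖ ≤ 1`").
* `IsMinimal.orthogonal_of_etheta_eq_zero` (p.4 after (9), row A7): `εθ = 0` forces `C' = 0`, hence
  `x₀ − ℓ'(T)y' ⟂ V r` for every `r` — the non-cyclic limit case the text sets aside.
* `IsMinimal.norm_le_of_le`, `IsMinimal.parallelogram` ((18), row A15): `ε ↦ ‖ℓ'_ε‖₂` is non-increasing, and for
  minimal vectors `a, b, c` at radii `ε, ε', (ε+ε')/2` one has `‖a − b‖² ≤ 2‖a‖² + 2‖b‖² − 4‖c‖²` — the quantitative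
  content of the continuity (18) (the text says (18) "follows from (14)"; it follows from convexity, as here).
* `coeff_sq_bounds` ((22)–(23), row A19): `Σ_{j≥0}|a_j|² = εθ` and `|a₀|² ≥ 100·Σ_{j≥1}|a_j|²` give
  `(100/101)εθ ≤ |a₀|² ≤ εθ` (the text prints the weaker `|a₀| > 0.1(εθ)^{1/2}`).
Origin: planner-b2b-enflo-1-0, 2026-08-18.  Imports `Literature.Analysis.OperatorTheory.Enflo2023.MinimalNorm`.
-/

noncomputable section

open scoped InnerProductSpace
open ContinuousLinearMap
open Literature.Analysis.UnboundedOperators (inner_self_eq_coe_norm_sq)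

namespace Literature.Analysis.OperatorTheory.Enflo2023

variable {E H : Type*} [NormedAddCommGroup E] [InnerProductSpace ℂ E] [CompleteSpace E]
  [NormedAddCommGroup H] [InnerProductSpace ℂ H] [CompleteSpace H]

omit [CompleteSpace H] in
/-- v2 p.4 l.1–2: `‖v‖² = 1 − ‖x₀ − v‖² − 2·Re ⟪x₀ − v, v⟫` when `‖x₀‖ = 1` (take `v = ℓ'(T)y'`: the last term is `2εθ`). [cite: Enflo2023, v2 p.4, l.1–2] -/
theorem norm_sq_move (x₀ v : H) (h0 : ‖x₀‖ = 1) :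
    ‖v‖ ^ 2 = 1 - ‖x₀ - v‖ ^ 2 - 2 * (⟪x₀ - v, v⟫_ℂ).re := by
  have h1 : ‖x₀ - v‖ ^ 2 = ‖x₀‖ ^ 2 - 2 * (⟪x₀, v⟫_ℂ).re + ‖v‖ ^ 2 := by
    have := norm_sub_sq (𝕜 := ℂ) x₀ v
    simpa using this
  have h2 : (⟪x₀ - v, v⟫_ℂ).re = (⟪x₀, v⟫_ℂ).re - ‖v‖ ^ 2 := by
    rw [inner_sub_left, Complex.sub_re, inner_self_eq_coe_norm_sq, Complex.ofReal_re]
  rw [h1, h2, h0]; ring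

omit [CompleteSpace H] in
/-- Hence `‖ℓ'(T)y'‖ ≤ 1` whenever `εθ = Re ⟪x₀ − v, v⟫ ≥ 0` and `‖x₀‖ = 1` (v2 p.4 l.1). [cite: Enflo2023, v2 p.4, l.1–2] -/
theorem norm_move_le_one (x₀ v : H) (h0 : ‖x₀‖ = 1) (hθ : 0 ≤ (⟪x₀ - v, v⟫_ℂ).re) : ‖v‖ ≤ 1 := by
  have h := norm_sq_move x₀ v h0
  nlinarith [sq_nonneg ‖x₀ - v‖, norm_nonneg v]

/-- (22)–(23): from `Σ_{j≥0}|a_j|² = εθ` (`s + r = θ`, `s = |a₀|²`, `r = Σ_{j≥1}|a_j|² ≥ 0`) and (22) `|a₀|² ≥ 100·r`: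
`(100/101)·εθ ≤ |a₀|² ≤ εθ`. [cite: Enflo2023, v2 p.8, eq. (22)–(23)] -/
theorem coeff_sq_bounds {θ s r : ℝ} (hsum : s + r = θ) (hr : 0 ≤ r) (h22 : 100 * r ≤ s) :
    100 / 101 * θ ≤ s ∧ s ≤ θ := by
  constructor <;> linarith

/-- (23), the `‖y‖`-window, as real arithmetic: with `m = (εθ)^{1/2} > 0`, `n = ‖y‖`, `s = |a₀| ∈ [0.995m, m]`
(`coeff_sq_bounds`), `P = ‖ℓ(T)y‖ ∈ [0.7, 0.96]` (`norm_sq_move` with `0.3 ≤ ε ≤ 0.5`, `εθ ≤ 0.1`) and the tail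
`t ≤ 10⁻¹⁹ m` (any sign; `Literature.Analysis.OperatorTheory.Enflo2023.Vy.norm_V_window` with `‖T‖ = 10⁻²⁰`): `s·n − t·n ≤ P ≤ s·n + t·n` forces
`(1/20)(εθ)^{-1/2} < ‖y‖ < (εθ)^{-1/2}`. [cite: Enflo2023, v2 p.8, eq. (23)] -/
theorem norm_y_window {m n s P t : ℝ} (hm : 0 < m) (hn : 0 ≤ n)
    (hs1 : 0.995 * m ≤ s) (hs2 : s ≤ m) (hP1 : 0.7 ≤ P) (hP2 : P ≤ 0.96)
    (ht : t ≤ m / 10 ^ 19)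
    (hlo : s * n - t * n ≤ P) (hhi : P ≤ s * n + t * n) :
    1 / (20 * m) < n ∧ n < 1 / m := by
  have hst1 : 0.99 * m ≤ s - t := by
    have : m / 10 ^ 19 ≤ 0.005 * m := by
      rw [div_le_iff₀ (by positivity)]; nlinarith
    linarith
  have hst2 : s + t ≤ 1.1 * m := by
    have : m / 10 ^ 19 ≤ 0.1 * m := by
      rw [div_le_iff₀ (by positivity)]; nlinarith
    linarith
  constructor
  · -- lower bound: 0.7 ≤ P ≤ n (s + t) ≤ 1.1 n m
    have h1 : P ≤ n * (1.1 * m) := by nlinarith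
    rw [div_lt_iff₀ (by positivity)]
    nlinarith
  · -- upper bound: n (s - t) ≤ P ≤ 0.96, s - t ≥ 0.99 m
    have h1 : n * (0.99 * m) ≤ 0.96 := by nlinarith
    rw [lt_div_iff₀ hm]
    nlinarith

/-! ### (20): the weak-limit expansion (v2 p.7) -/

section eq20
open Filter Topology

omit [CompleteSpace H] in
/-- v2 p.7, the sentence before (20): if `v_n → v` in norm and `⟪A v_n, v_n⟫ → 0` then `⟪A v, v⟫ = 0`
(so `T^m y'_∞` is non-cyclic when the convergence `y_n/‖y_n‖ → y'_∞` is in norm). [cite: Enflo2023, v2 p.7, before eq. (20)] -/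
theorem inner_eq_zero_of_tendsto (A : H →L[ℂ] H) {v : ℕ → H} {v₀ : H} (hv : Tendsto v atTop (𝓝 v₀))
    (h0 : Tendsto (fun n => ⟪A (v n), v n⟫_ℂ) atTop (𝓝 0)) : ⟪A v₀, v₀⟫_ℂ = 0 := by
  have h1 : Tendsto (fun n => ⟪A (v n), v n⟫_ℂ) atTop (𝓝 ⟪A v₀, v₀⟫_ℂ) :=
    ((A.continuous.tendsto v₀).comp hv).inner hv
  exact tendsto_nhds_unique h1 h0

/-- **(20)** (v2 p.7): if `s_n ⇀ 0` weakly and `(α_n)` is bounded then, for every bounded `A` (the paper: `A = T^j`)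
and every `z` (the paper: `z = y'_∞`), the cross terms of `⟪A(α_n z + s_n), α_n z + s_n⟫` vanish in the limit:
`⟪A(α_n z + s_n), α_n z + s_n⟫ − ⟪A(α_n z), α_n z⟫ − ⟪A s_n, s_n⟫ → 0`.  Hence `⟪T^j(y_n/‖y_n‖), y_n/‖y_n‖⟫ → 0`
(type 2) gives (20). [cite: Enflo2023, v2 p.7, eq. (20)] -/
theorem eq20_cross_terms (A : H →L[ℂ] H) (z : H) (s : ℕ → H) (α : ℕ → ℂ) {M : ℝ}
    (hα : ∀ n, ‖α n‖ ≤ M) (hs : ∀ w : H, Tendsto (fun n => ⟪w, s n⟫_ℂ) atTop (𝓝 0)) :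
    Tendsto (fun n => ⟪A (α n • z + s n), α n • z + s n⟫_ℂ
      - (⟪A (α n • z), α n • z⟫_ℂ + ⟪A (s n), s n⟫_ℂ)) atTop (𝓝 0) := by
  have hM : 0 ≤ M := le_trans (norm_nonneg _) (hα 0)
  -- the two cross terms
  have e : ∀ n, ⟪A (α n • z + s n), α n • z + s n⟫_ℂ - (⟪A (α n • z), α n • z⟫_ℂ + ⟪A (s n), s n⟫_ℂ)
      = (starRingEnd ℂ) (α n) * ⟪A z, s n⟫_ℂ + α n * (starRingEnd ℂ) ⟪adjoint A z, s n⟫_ℂ := by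
    intro n
    rw [map_add, inner_add_left, inner_add_right, inner_add_right, map_smul, inner_smul_left, inner_smul_left,
      inner_smul_right, inner_smul_right, inner_conj_symm, adjoint_inner_right]
    ring
  simp_rw [e]
  have h1 : Tendsto (fun n => (starRingEnd ℂ) (α n) * ⟪A z, s n⟫_ℂ) atTop (𝓝 0) := by
    apply squeeze_zero_norm (fun n => ?_) (by simpa using (hs (A z)).norm.const_mul M)
    rw [norm_mul, Complex.norm_conj]
    exact mul_le_mul_of_nonneg_right (hα n) (norm_nonneg _)
  have h2 : Tendsto (fun n => α n * (starRingEnd ℂ) ⟪adjoint A z, s n⟫_ℂ) atTop (𝓝 0) := by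
    apply squeeze_zero_norm (fun n => ?_) (by simpa using (hs (adjoint A z)).norm.const_mul M)
    rw [norm_mul, Complex.norm_conj]
    exact mul_le_mul_of_nonneg_right (hα n) (norm_nonneg _)
  simpa using h1.add h2

end eq20

namespace IsMinimal

variable {V : E →L[ℂ] H} {x₀ : H} {ε : ℝ} {a : E}

/-- v2 p.4 after (9): if `εθ = Re ⟪x₀ − Vℓ', Vℓ'⟫ = 0` (and `ℓ' ≠ 0`) then the multiplier `C'` vanishes and
`x₀ − V ℓ'` is orthogonal to every `V r` — so `T` has a non-cyclic vector. [cite: Enflo2023, v2 p.4, after eq. (9)] -/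
theorem orthogonal_of_etheta_eq_zero (h : IsMinimal V x₀ ε a) (ha : a ≠ 0)
    (hθ : (⟪x₀ - V a, V a⟫_ℂ).re = 0) (r : E) : ⟪x₀ - V a, V r⟫_ℂ = 0 := by
  obtain ⟨C, -, hC⟩ := h.kkt ha
  have h6 : (⟪x₀ - V a, V a⟫_ℂ).re = C * ‖a‖ ^ 2 := by rw [eq6 hC, Complex.ofReal_re]
  have hCz : C = 0 := by
    have ha' : 0 < ‖a‖ ^ 2 := by have := norm_pos_iff.2 ha; positivity
    have hm : C * ‖a‖ ^ 2 = 0 := by rw [← h6, hθ]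
    rcases mul_eq_zero.1 hm with h1 | h1
    · exact h1
    · exact absurd h1 ha'.ne'
  subst hCz
  exact inner_eq_zero_of_C_eq_zero hC r

omit [CompleteSpace E] [CompleteSpace H] in
/-- (18): the minimal norm is non-increasing in the radius — if `ε ≤ ε'` then `‖ℓ'_{ε'}‖₂ ≤ ‖ℓ'_ε‖₂`. [cite: Enflo2023, v2 p.5, eq. (18)] -/
theorem norm_le_of_le {ε' : ℝ} {b : E} (h : IsMinimal V x₀ ε a) (h' : IsMinimal V x₀ ε' b)
    (hle : ε ≤ ε') : ‖b‖ ≤ ‖a‖ :=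
  h'.2 a (le_trans (show ‖x₀ - V a‖ ≤ ε from h.1) hle)

omit [CompleteSpace E] [CompleteSpace H] in
/-- (18), quantitative: for minimal vectors `a, b, c` at radii `ε, ε', (ε + ε')/2`,
`‖a − b‖² ≤ 2‖a‖² + 2‖b‖² − 4‖c‖²` (midpoint feasibility + parallelogram law).  Since `ε ↦ ‖ℓ'_ε‖` is
convex and monotone, hence continuous inside its domain, this gives the continuity `ε ↦ ℓ'_ε` of (18). [cite: Enflo2023, v2 p.5, eq. (18)] -/
theorem parallelogram {ε' : ℝ} {b c : E} (ha : IsMinimal V x₀ ε a) (hb : IsMinimal V x₀ ε' b)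
    (hc : IsMinimal V x₀ ((ε + ε') / 2) c) :
    ‖a - b‖ ^ 2 ≤ 2 * ‖a‖ ^ 2 + 2 * ‖b‖ ^ 2 - 4 * ‖c‖ ^ 2 := by
  -- the midpoint is feasible at the mean radius
  have hmid : ((1 / 2 : ℝ) : ℂ) • (a + b) ∈ feasible V x₀ ((ε + ε') / 2) := by
    rw [mem_feasible]
    have e1 : x₀ - V (((1 / 2 : ℝ) : ℂ) • (a + b)) =
        ((1 / 2 : ℝ) : ℂ) • (x₀ - V a) + ((1 / 2 : ℝ) : ℂ) • (x₀ - V b) := by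
      rw [map_smul, map_add, smul_sub, smul_sub, smul_add]
      have : x₀ = ((1 / 2 : ℝ) : ℂ) • x₀ + ((1 / 2 : ℝ) : ℂ) • x₀ := by
        rw [← add_smul]; norm_num
      conv_lhs => rw [this]
      abel
    rw [e1]
    calc ‖((1 / 2 : ℝ) : ℂ) • (x₀ - V a) + ((1 / 2 : ℝ) : ℂ) • (x₀ - V b)‖
        ≤ ‖((1 / 2 : ℝ) : ℂ) • (x₀ - V a)‖ + ‖((1 / 2 : ℝ) : ℂ) • (x₀ - V b)‖ := norm_add_le _ _
      _ = 1 / 2 * ‖x₀ - V a‖ + 1 / 2 * ‖x₀ - V b‖ := by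
          rw [norm_smul, norm_smul, Complex.norm_real, Real.norm_of_nonneg (by norm_num)]
      _ ≤ 1 / 2 * ε + 1 / 2 * ε' := by
          gcongr
          · exact (show ‖x₀ - V a‖ ≤ ε from ha.1)
          · exact (show ‖x₀ - V b‖ ≤ ε' from hb.1)
      _ = (ε + ε') / 2 := by ring
  have hcle : ‖c‖ ≤ 1 / 2 * ‖a + b‖ := by
    have := hc.2 _ hmid
    rwa [norm_smul, Complex.norm_real, Real.norm_of_nonneg (by norm_num)] at this
  have hpar : ‖a + b‖ ^ 2 + ‖a - b‖ ^ 2 = 2 * (‖a‖ ^ 2 + ‖b‖ ^ 2) :=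
    parallelogram_law_with_norm ℂ a b
  have hc0 : 0 ≤ ‖c‖ := norm_nonneg c
  nlinarith [norm_nonneg (a + b)]

end IsMinimal

end Literature.Analysis.OperatorTheory.Enflo2023

end
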